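import Summits.Ventures.WeilGRH.TwistedFarAssembly
import Summits.Ventures.WeilGRH.TwistedGramOddReal
import Summits.Ventures.WeilGRH.TwistedParityBonus
import HarnessLib

/-!
# GRH arm (rh-explicit, venture WeilGRH): twisted format C with the PARITY-1 kernel — the `sech` bonus block is PSD on every
  section, so the parity-0 far diagonals serve `twistedGramCoeffOdd χ a` (L-C3a for odd real characters)

Cell `rh-explicit`, WEIL TRACK — GRH ARM (lit/typing seat weil-grh-5 gen11; answer to weil-grh-2 gen7's ASK, INBOX
2026-08-23T09:30Z: «the door's parity-0 kernel makes the even-sector form of every ODD real character of small conductor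
NEGATIVE … the ODD data-only door = TwistedDataRung on `twistedGramCoeffOdd`: parity-0 far diagonals stay valid (Π ≥ 0 on
far modes) …»).  weil-grh-1's parity-1 kernel is `twistedGramCoeffOdd χ a = twistedGramCoeff χ a + π δ − sechIncrCoeff a`
(`TwistedGramOddReal.lean`).  The bonus block `Π = π δ − sechIncrCoeff a` is the matrix of `π‖u‖² − ∫₀^∞ σ D_t(u)` on
Yoshida's windows, which is `≥ 0` for EVERY window (`parity_bonus_nonneg`, `TwistedParityBonus.lean`).  Hence:

* `sechBonus_form_nonneg` — `0 ≤ Σ_{n,m∈s} x_n x_m (π δ_{nm} − sechIncrCoeff a n m)` for every finite `s ⊆ ℤ`, real `x`;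
* `sechBonus_evenSector_nonneg`, `sechBonus_oddSector_nonneg` — the same for weil-2's SectorSplit kernels of `Π`
  (an even / odd extension of the sector vector through `sum_modes_mul_mul_eq_sectors`);
* `twistedGramCoeffOdd_even_far_ge_diag`, `twistedGramCoeffOdd_odd_far_ge_diag_atan` — **twisted L-C3a for the parity-1
  kernel**: the `hfar_e` / `hfar_o` inputs of weil-grh-1's `weilPositivityOnChar_of_formatC_certificates_odd` with the SAME
  closed-form far diagonals `d̂⁺_χ`, `d̂⁻_χ` as the parity-0 kernel (`TwistedFarAssembly.lean`).

What this does NOT type (successor; recipe in GRH-LIT-AS-PRINTED A49): the `sech` column tail — `sechIncrCoeff a n m =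
−(−1)^{n+m}(I_m − I_n)/(π(n−m))`, `I_n = ∫₀^{2a} σ(t) sin(ω_n t) dt = O(1/ω_n)` by one integration by parts, so the sector
columns of `Π` are `O(1/m²)` and add one constant `κ_σ` to the order-1 tail majorants.  No definitions; no named facts;
RH/GRH-free; standard axioms.
-/

set_option autoImplicit false

noncomputable section

open Complex Finset MeasureTheory Set
open scoped Real BigOperators ComplexConjugate ArithmeticFunction.vonMangoldt

namespace Summit.Ventures.WeilGRH

open Literature.NumberTheory.LFunctions
open Literature.NumberTheory.LFunctions.Yoshida1992 (modes chi freq mem_modes)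
open Literature.Analysis.SpecialFunctions
open Summit.RiemannHypothesis.RiemannHypothesis.Theorems.WeilFormatC

variable {q : ℕ} {a : ℝ}

/-! ## The bonus block is positive semidefinite on every section -/

section Bonus

/-- **`0 ≤ Σ_{n,m∈s} x_n x_m (π δ_{nm} − sechIncrCoeff a n m)`** for every finite set of modes and every real vector:
the bonus block is the Gram matrix of `π‖u‖² − ∫₀^∞ σ D_t(u) ≥ 0` on `u = Σ x_n χ_n`. -/
theorem sechBonus_form_nonneg (ha : 0 < a) (s : Finset ℤ) (x : ℤ → ℝ) :
    0 ≤ ∑ n ∈ s, ∑ m ∈ s, x n * x m * ((if n = m then π else 0) - sechIncrCoeff a n m) := by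
  set c : ℤ → ℂ := fun n ↦ ((x n : ℝ) : ℂ) with hc
  have hpos := parity_bonus_nonneg (a := a) (measurable_sum_smul_chi s c)
    (fun y hy ↦ sum_smul_chi_eq_zero _ _ hy) (fun y ↦ norm_sum_smul_chi_le s c y)
  rw [integral_norm_sq_sum_smul_chi ha s c, setIntegral_sech_mul_weilIncrement_sum_smul_chi ha s c] at hpos
  have hcc : ∀ n m : ℤ, (conj (c n) * c m).re = x n * x m := fun n m ↦ by
    simp only [hc, Complex.conj_ofReal, ← Complex.ofReal_mul, Complex.ofReal_re]
  have hnorm : ∀ n : ℤ, ‖c n‖ ^ 2 = x n * x n := fun n ↦ by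
    simp only [hc, Complex.norm_real, Real.norm_eq_abs, sq, abs_mul_abs_self]
  simp_rw [hcc, hnorm] at hpos
  have e : ∑ n ∈ s, ∑ m ∈ s, x n * x m * ((if n = m then π else 0) - sechIncrCoeff a n m)
      = π * ∑ n ∈ s, x n * x n - ∑ n ∈ s, ∑ m ∈ s, x n * x m * sechIncrCoeff a n m := by
    simp_rw [mul_sub, Finset.sum_sub_distrib, mul_ite, mul_zero]
    congr 1
    rw [Finset.mul_sum]
    refine Finset.sum_congr rfl fun n hn ↦ ?_
    rw [Finset.sum_ite_eq s n, if_pos hn]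
    ring
  rw [e]
  exact hpos

/-- **Even-sector form of the bonus block is `≥ 0`** (weil-2's even SectorSplit kernel of `Π = πδ − sechIncrCoeff a`). -/
theorem sechBonus_evenSector_nonneg (ha : 0 < a) (N : ℕ) (y : ℕ → ℝ) :
    0 ≤ ∑ n ∈ Finset.range (N + 1), ∑ m ∈ Finset.range (N + 1), y n * y m *
      (if n = 0 then ((if (0 : ℤ) = (m : ℤ) then π else 0) - sechIncrCoeff a 0 m)
        else if m = 0 then ((if (n : ℤ) = 0 then π else 0) - sechIncrCoeff a n 0)
        else (((if (n : ℤ) = m then π else 0) - sechIncrCoeff a n m)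
          + ((if (n : ℤ) = -(m : ℤ) then π else 0) - sechIncrCoeff a n (-(m : ℤ)))) / 2) := by
  -- the even extension `x 0 = y 0`, `x (±n) = y n / 2`
  set P : ℤ → ℤ → ℝ := fun n m ↦ (if n = m then π else 0) - sechIncrCoeff a n m with hP
  have hrefl : ∀ n m, P (-n) (-m) = P n m := fun n m ↦ by
    simp only [hP, sechIncrCoeff_neg_neg, neg_inj]
  set x : ℤ → ℝ := fun p ↦ if p = 0 then y 0 else y p.natAbs / 2 with hx
  have h := sechBonus_form_nonneg ha (modes N) x
  have hsplit := sum_modes_mul_mul_eq_sectors P hrefl N x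
  have hev : ∀ n : ℕ, (if n = 0 then x 0 else x n + x (-(n : ℤ))) = y n := fun n ↦ by
    by_cases hn : n = 0
    · subst hn; simp [hx]
    · have h1 : (n : ℤ) ≠ 0 := by exact_mod_cast hn
      have h2 : (-(n : ℤ)) ≠ 0 := neg_ne_zero.mpr h1
      simp only [hx, if_neg hn, if_neg h1, if_neg h2, Int.natAbs_neg, Int.natAbs_natCast]
      ring
  have hod : ∀ k : ℕ, x ((k : ℤ) + 1) - x (-((k : ℤ) + 1)) = 0 := fun k ↦ by
    have h1 : ((k : ℤ) + 1) ≠ 0 := by omega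
    have h2 : (-((k : ℤ) + 1)) ≠ 0 := by omega
    have h3 : (-((k : ℤ) + 1)).natAbs = ((k : ℤ) + 1).natAbs := Int.natAbs_neg _
    simp only [hx, if_neg h1, if_neg h2, h3, sub_self]
  simp_rw [hev, hod, zero_mul, Finset.sum_const_zero, add_zero] at hsplit
  simp only [hP] at h hsplit
  rw [hsplit] at h
  exact h

/-- **Odd-sector form of the bonus block is `≥ 0`** (weil-2's odd SectorSplit kernel of `Π`). -/
theorem sechBonus_oddSector_nonneg (ha : 0 < a) (N : ℕ) (z : ℕ → ℝ) :
    0 ≤ ∑ k ∈ Finset.range N, ∑ l ∈ Finset.range N, z k * z l *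
      ((((if ((k : ℤ) + 1) = ((l : ℤ) + 1) then π else 0) - sechIncrCoeff a ((k : ℤ) + 1) ((l : ℤ) + 1))
        - ((if ((k : ℤ) + 1) = -((l : ℤ) + 1) then π else 0) - sechIncrCoeff a ((k : ℤ) + 1) (-((l : ℤ) + 1)))) / 2) := by
  set P : ℤ → ℤ → ℝ := fun n m ↦ (if n = m then π else 0) - sechIncrCoeff a n m with hP
  have hrefl : ∀ n m, P (-n) (-m) = P n m := fun n m ↦ by
    simp only [hP, sechIncrCoeff_neg_neg, neg_inj]
  -- the odd extension `x 0 = 0`, `x (k+1) = z k / 2`, `x (−(k+1)) = −z k / 2`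
  set x : ℤ → ℝ := fun p ↦ if 0 < p then z (p.natAbs - 1) / 2 else if p < 0 then -(z (p.natAbs - 1) / 2) else 0
    with hx
  have h := sechBonus_form_nonneg ha (modes N) x
  have hsplit := sum_modes_mul_mul_eq_sectors P hrefl N x
  have hev : ∀ n : ℕ, (if n = 0 then x 0 else x n + x (-(n : ℤ))) = 0 := fun n ↦ by
    by_cases hn : n = 0
    · subst hn; simp [hx]
    · have h1 : (0 : ℤ) < (n : ℤ) := by omega
      have h2 : ¬ (0 : ℤ) < -(n : ℤ) := by omega
      have h3 : -(n : ℤ) < 0 := by omega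
      simp only [hx, if_neg hn, if_pos h1, if_neg h2, if_pos h3, Int.natAbs_neg, Int.natAbs_natCast]
      ring
  have hod : ∀ k : ℕ, x ((k : ℤ) + 1) - x (-((k : ℤ) + 1)) = z k := fun k ↦ by
    have h1 : (0 : ℤ) < (k : ℤ) + 1 := by omega
    have h2 : ¬ (0 : ℤ) < -((k : ℤ) + 1) := by omega
    have h3 : -((k : ℤ) + 1) < 0 := by omega
    have h4 : ((k : ℤ) + 1).natAbs - 1 = k := by omega
    have h5 : (-((k : ℤ) + 1)).natAbs - 1 = k := by omega
    simp only [hx, if_pos h1, if_neg h2, if_pos h3, h4, h5]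
    ring
  simp_rw [hev, hod, zero_mul, Finset.sum_const_zero, zero_add] at hsplit
  simp only [hP] at h hsplit
  rw [hsplit] at h
  exact h

end Bonus

/-! ## L-C3a for the parity-1 kernel -/

section Far

/-- The even SectorSplit kernel of `twistedGramCoeffOdd` is that of `twistedGramCoeff` plus that of the bonus block. -/
private theorem evenKernel_odd_split (χ : DirichletCharacter ℂ q) (a : ℝ) (n m : ℕ) :
    (if n = 0 then twistedGramCoeffOdd χ a 0 m else if m = 0 then twistedGramCoeffOdd χ a n 0
        else (twistedGramCoeffOdd χ a n m + twistedGramCoeffOdd χ a n (-(m : ℤ))) / 2)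
      = (if n = 0 then twistedGramCoeff χ a 0 m else if m = 0 then twistedGramCoeff χ a n 0
          else (twistedGramCoeff χ a n m + twistedGramCoeff χ a n (-(m : ℤ))) / 2)
        + (if n = 0 then ((if (0 : ℤ) = (m : ℤ) then π else 0) - sechIncrCoeff a 0 m)
          else if m = 0 then ((if (n : ℤ) = 0 then π else 0) - sechIncrCoeff a n 0)
          else (((if (n : ℤ) = m then π else 0) - sechIncrCoeff a n m)
            + ((if (n : ℤ) = -(m : ℤ) then π else 0) - sechIncrCoeff a n (-(m : ℤ)))) / 2) := by
  unfold twistedGramCoeffOdd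
  split_ifs <;> ring

/-- The odd SectorSplit kernel of `twistedGramCoeffOdd` splits likewise. -/
private theorem oddKernel_odd_split (χ : DirichletCharacter ℂ q) (a : ℝ) (k l : ℕ) :
    (twistedGramCoeffOdd χ a ((k : ℤ) + 1) ((l : ℤ) + 1) - twistedGramCoeffOdd χ a ((k : ℤ) + 1) (-((l : ℤ) + 1))) / 2
      = (twistedGramCoeff χ a ((k : ℤ) + 1) ((l : ℤ) + 1) - twistedGramCoeff χ a ((k : ℤ) + 1) (-((l : ℤ) + 1))) / 2
        + ((((if ((k : ℤ) + 1) = ((l : ℤ) + 1) then π else 0) - sechIncrCoeff a ((k : ℤ) + 1) ((l : ℤ) + 1))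
          - ((if ((k : ℤ) + 1) = -((l : ℤ) + 1) then π else 0) - sechIncrCoeff a ((k : ℤ) + 1) (-((l : ℤ) + 1)))) / 2) := by
  unfold twistedGramCoeffOdd
  ring

/-- A form over `Ico B N × Ico B N` is the form over `range (N'+1)²` of the truncated vector. -/
private theorem sum_Ico_Ico_eq_sum_range (K : ℕ → ℕ → ℝ) (B N : ℕ) (y : ℕ → ℝ) :
    ∑ n ∈ Finset.Ico B N, ∑ m ∈ Finset.Ico B N, y n * K n m * y m
      = ∑ n ∈ Finset.range (N + 1), ∑ m ∈ Finset.range (N + 1),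
          (if B ≤ n ∧ n < N then y n else 0) * (if B ≤ m ∧ m < N then y m else 0) * K n m := by
  have hsub : Finset.Ico B N ⊆ Finset.range (N + 1) := fun j hj ↦ by
    rw [Finset.mem_Ico] at hj; rw [Finset.mem_range]; omega
  rw [← Finset.sum_subset hsub (fun n _ hn ↦ by
    refine Finset.sum_eq_zero fun m _ ↦ ?_
    rw [Finset.mem_Ico] at hn
    rw [if_neg hn]; ring)]
  refine Finset.sum_congr rfl fun n hn ↦ ?_
  rw [← Finset.sum_subset hsub (fun m _ hm ↦ by
    rw [Finset.mem_Ico] at hm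
    rw [if_neg hm]; ring)]
  refine Finset.sum_congr rfl fun m hm ↦ ?_
  rw [Finset.mem_Ico] at hn hm
  rw [if_pos hn, if_pos hm]
  ring

/-- **L-C3a for the parity-1 kernel, even sector**: the parity-0 far diagonal `d̂⁺_χ` of `TwistedFarAssembly.lean` bounds
the even SectorSplit kernel of `twistedGramCoeffOdd χ a` on the far modes (`2 ≤ B`). -/
theorem twistedGramCoeffOdd_even_far_ge_diag (χ : DirichletCharacter ℂ q) (ha : 0 < a) {B : ℕ} (hB : 2 ≤ B)
    (N : ℕ) (y : ℕ → ℝ) :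
    ∑ n ∈ Finset.Ico B N,
        ((reDigammaQuarter (freq a n) - Real.log π + Real.log q) / 2
          - a * (1 + weilArchDensity (2 * a)) / (π ^ 2 * n ^ 2)
          - 1 / (8 * n) - a * (1 + weilArchDensity (2 * a)) / π ^ 2 * Real.sqrt (8 / ((B - 1 : ℕ) : ℝ))
          - (∑ k ∈ weilPrimeIndex a, (Λ k : ℝ) / Real.sqrt k * (2 * Real.cos (π / (⌊2 * a / Real.log k⌋₊ + 2)))) / 2)
          * y n ^ 2
      ≤ ∑ n ∈ Finset.Ico B N, ∑ m ∈ Finset.Ico B N,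
          y n * (if n = 0 then twistedGramCoeffOdd χ a 0 m else if m = 0 then twistedGramCoeffOdd χ a n 0
            else (twistedGramCoeffOdd χ a n m + twistedGramCoeffOdd χ a n (-(m : ℤ))) / 2) * y m := by
  have h0 := twistedGramCoeff_even_far_ge_diag χ ha hB N y
  have e : ∑ n ∈ Finset.Ico B N, ∑ m ∈ Finset.Ico B N, y n * (if n = 0 then twistedGramCoeffOdd χ a 0 m else if m = 0 then twistedGramCoeffOdd χ a n 0
            else (twistedGramCoeffOdd χ a n m + twistedGramCoeffOdd χ a n (-(m : ℤ))) / 2) * y m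
      = (∑ n ∈ Finset.Ico B N, ∑ m ∈ Finset.Ico B N, y n * (if n = 0 then twistedGramCoeff χ a 0 m else if m = 0 then twistedGramCoeff χ a n 0
            else (twistedGramCoeff χ a n m + twistedGramCoeff χ a n (-(m : ℤ))) / 2) * y m)
        + ∑ n ∈ Finset.Ico B N, ∑ m ∈ Finset.Ico B N, y n * (if n = 0 then ((if (0 : ℤ) = (m : ℤ) then π else 0) - sechIncrCoeff a 0 m)
          else if m = 0 then ((if (n : ℤ) = 0 then π else 0) - sechIncrCoeff a n 0)
          else (((if (n : ℤ) = m then π else 0) - sechIncrCoeff a n m)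
            + ((if (n : ℤ) = -(m : ℤ) then π else 0) - sechIncrCoeff a n (-(m : ℤ)))) / 2) * y m := by
    rw [← Finset.sum_add_distrib]
    refine Finset.sum_congr rfl fun n _ ↦ ?_
    rw [← Finset.sum_add_distrib]
    refine Finset.sum_congr rfl fun m _ ↦ ?_
    rw [evenKernel_odd_split]
    ring
  rw [e]
  have hP : 0 ≤ ∑ n ∈ Finset.Ico B N, ∑ m ∈ Finset.Ico B N,
      y n * (if n = 0 then ((if (0 : ℤ) = (m : ℤ) then π else 0) - sechIncrCoeff a 0 m)
          else if m = 0 then ((if (n : ℤ) = 0 then π else 0) - sechIncrCoeff a n 0)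
          else (((if (n : ℤ) = m then π else 0) - sechIncrCoeff a n m)
            + ((if (n : ℤ) = -(m : ℤ) then π else 0) - sechIncrCoeff a n (-(m : ℤ)))) / 2) * y m := by
    rw [sum_Ico_Ico_eq_sum_range]
    exact sechBonus_evenSector_nonneg ha N _
  linarith

/-- **L-C3a for the parity-1 kernel, odd sector (arctan weight)**: the parity-0 far diagonal `d̂⁻_χ` bounds the odd
SectorSplit kernel of `twistedGramCoeffOdd χ a` on the far modes (`1 ≤ B`). -/
theorem twistedGramCoeffOdd_odd_far_ge_diag_atan (χ : DirichletCharacter ℂ q) (ha : 0 < a) {B : ℕ} (hB : 1 ≤ B)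
    (N : ℕ) (z : ℕ → ℝ) :
    ∑ k ∈ Finset.Ico B N,
        ((reDigammaQuarter (freq a ((k : ℤ) + 1)) - Real.log π + Real.log q) / 2 - 1 / (8 * ((k : ℝ) + 1))
          - a * (1 + weilArchDensity (2 * a)) / (π ^ 2 * ((k : ℝ) + 1) ^ 2)
          - (π / 2 - Real.arctan (Real.sqrt B / Real.sqrt ((k : ℝ) + 1))) / 2
          - a * (1 + weilArchDensity (2 * a)) / π ^ 2 * Real.sqrt (8 / B)
          - (∑ k ∈ weilPrimeIndex a, (Λ k : ℝ) / Real.sqrt k * (2 * Real.cos (π / (⌊2 * a / Real.log k⌋₊ + 2)))) / 2)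
          * z k ^ 2
      ≤ ∑ k ∈ Finset.Ico B N, ∑ l ∈ Finset.Ico B N,
          z k * ((twistedGramCoeffOdd χ a ((k : ℤ) + 1) ((l : ℤ) + 1) -
            twistedGramCoeffOdd χ a ((k : ℤ) + 1) (-((l : ℤ) + 1))) / 2) * z l := by
  have h0 := twistedGramCoeff_odd_far_ge_diag_atan χ ha hB N z
  have e : ∑ k ∈ Finset.Ico B N, ∑ l ∈ Finset.Ico B N, z k * ((twistedGramCoeffOdd χ a ((k : ℤ) + 1) ((l : ℤ) + 1) -
            twistedGramCoeffOdd χ a ((k : ℤ) + 1) (-((l : ℤ) + 1))) / 2) * z l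
      = (∑ k ∈ Finset.Ico B N, ∑ l ∈ Finset.Ico B N, z k * ((twistedGramCoeff χ a ((k : ℤ) + 1) ((l : ℤ) + 1) - twistedGramCoeff χ a ((k : ℤ) + 1) (-((l : ℤ) + 1))) / 2) * z l)
        + ∑ k ∈ Finset.Ico B N, ∑ l ∈ Finset.Ico B N, z k * ((((if ((k : ℤ) + 1) = ((l : ℤ) + 1) then π else 0) - sechIncrCoeff a ((k : ℤ) + 1) ((l : ℤ) + 1))
        - ((if ((k : ℤ) + 1) = -((l : ℤ) + 1) then π else 0) - sechIncrCoeff a ((k : ℤ) + 1) (-((l : ℤ) + 1)))) / 2) * z l := by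
    rw [← Finset.sum_add_distrib]
    refine Finset.sum_congr rfl fun k _ ↦ ?_
    rw [← Finset.sum_add_distrib]
    refine Finset.sum_congr rfl fun l _ ↦ ?_
    rw [oddKernel_odd_split]
    ring
  rw [e]
  have hP : 0 ≤ ∑ k ∈ Finset.Ico B N, ∑ l ∈ Finset.Ico B N,
      z k * ((((if ((k : ℤ) + 1) = ((l : ℤ) + 1) then π else 0) - sechIncrCoeff a ((k : ℤ) + 1) ((l : ℤ) + 1))
        - ((if ((k : ℤ) + 1) = -((l : ℤ) + 1) then π else 0) - sechIncrCoeff a ((k : ℤ) + 1) (-((l : ℤ) + 1)))) / 2)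
        * z l := by
    rw [sum_Ico_Ico_eq_sum_range]
    exact sechBonus_oddSector_nonneg ha (N + 1) _
  linarith

end Far

end Summit.Ventures.WeilGRH

end
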